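import Summits.Ventures.YMGap.Conjectures.ChiralClockComparison
import Mathlib.Analysis.SpecialFunctions.Complex.Arg
import Mathlib.Analysis.SpecialFunctions.Exponential
import Mathlib.Algebra.BigOperators.Ring.Finset
import HarnessLib

/-!
# Venture YMGap — Conjectures/ChiralClockComparisonProof.lean: THE TYPED CONJECTURE (C) `ChiralClockComparison` IS A THEOREM
# — the Messager–Miracle-Solé–Pfister duplication with `ℤ₃` half-angles (`2` is a unit of `ℤ₃`)

HONEST FRAMING (venture `Summits/Ventures/YMGap`, cell `pub-ymgap`, track Y2 ROBUST-BALL, seat ds-4 g15).  Theorems only (finite sums over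
`Fin n → ZMod 3` and one exponential power series; no measure theory, no gauge fields).  This file PROVES the statement typed as
`@[conjecture] def ChiralClockComparison` in `Conjectures/ChiralClockComparison.lean`: for every `n`, all couplings `a ≥ 0` on ordered pairs,
all phases `φ` and all `b, t`, `‖⟨ω^{k_b−k_t}⟩_{a,φ}‖ ≤ Re ⟨ω^{k_b−k_t}⟩_{a,0}`.  The proof is the duplication argument of Messager,
Miracle-Solé and Pfister for the plane rotator (Commun. Math. Phys. 58 (1978) 19, Prop. 1; restated with proof in C. Garban, T. Spencer,
J. Math. Phys. 63 (2022), Appendix, Thm 21: duplicate the spins, pass to half-angles `(θ ± θ')/2`, expand, every term is a square), which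
transfers line by line to `ℤ₃`-valued spins BECAUSE `2` IS INVERTIBLE MOD `3`: the sitewise substitution `k = p − q`, `k' = p + q`
(inverse `p = 2(k + k')`, `q = 2(k' − k)`) is a bijection of `(ℤ₃^V)²`, and with `α = 2πP/3 + φ/2`, `β = 2πQ/3 + φ/2` (`P = p_u − p_v`,
`Q = q_u − q_v`) one has `cos(2π(P−Q)/3) + cos(2π(P+Q)/3 + φ) = 2 cos α cos β` and `cos(2π(P−Q)/3) − cos(2π(P+Q)/3 − ψ) = 2 sin · sin ·`.
Hence, for every real `ψ` (`chiralClock_duplication`),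
`Z_0 Z_φ (⟨cos(2πk_{bt}/3)⟩_{a,0} − ⟨cos(2πk_{bt}/3 − ψ)⟩_{a,φ}) = 2 ∑_{p,q} h(p) h(q) exp(∑_{(u,v)} 2a_{uv} G_{uv}(p) G_{uv}(q))`
with `h(p) = sin(2π(p_b−p_t)/3 − ψ/2)`, `G_{uv}(p) = cos(2π(p_u−p_v)/3 + φ_{uv}/2)`; the kernel is the entrywise exponential of a
non-negative combination of rank-one kernels, so the right side is `≥ 0` (`sum_mul_mul_exp_sum_nonneg`: expand `exp` in its power series
and each power by `Fintype.sum_pow` into squares).  Taking `ψ = arg ⟨ω^{k_b−k_t}⟩_{a,φ}` gives (C) (`chiralClockComparison_holds`); `φ`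
arbitrary with `c = 0`-case included gives Griffiths' first inequality `0 ≤ Re ⟨ω^{k_b−k_t}⟩_{a,0}` (`chiralClockCorr_zero_re_nonneg`).
PRIOR ART / STATUS OF THE STATEMENT: the mechanism is MMP 1978 as cited; whether the odd-`ℤ_n` clock case is already printed in MMP's general
framework is not decided here (primary source not held by the cell) — no novelty is claimed for the inequality, only its kernel proof.  By itself
this is a finite-sum inequality; the `SU(3)` centre-blind ladder beyond rung 1 additionally needs the layer translation and a ferromagnetic
`ℤ₃` two-point bound, neither of which is in this file.  Nothing continuum / Clay.
-/

noncomputable section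

open Finset Real

namespace Summit.Ventures.YMGap.Conjectures

variable {n : ℕ}

/-! ### Positivity: `∑_{p,q} h(p) h(q) exp(∑_j c_j G_j(p) G_j(q)) ≥ 0` for `c ≥ 0` -/

/-- Powers of a non-negative combination of rank-one kernels are positive semidefinite:
`0 ≤ ∑_{p,q} h(p) h(q) (∑_j c_j G_j(p) G_j(q))^N` (expand the power over maps `Fin N → J`; each term is `(∏ c)·(∑_p h(p) ∏ G(p))²`).
[cite: MessagerMiracleSolePfister1978, Prop. 1] -/
theorem sum_mul_mul_pow_sum_nonneg {X J : Type*} [Fintype X] [Fintype J] (h : X → ℝ) (c : J → ℝ) (hc : ∀ j, 0 ≤ c j)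
    (G : J → X → ℝ) (N : ℕ) :
    0 ≤ ∑ p, ∑ q, h p * h q * (∑ j, c j * (G j p * G j q)) ^ N := by
  have hexp : ∀ p q : X, (∑ j, c j * (G j p * G j q)) ^ N =
      ∑ t : Fin N → J, (∏ i, c (t i)) * ((∏ i, G (t i) p) * ∏ i, G (t i) q) := by
    intro p q
    rw [Fintype.sum_pow]
    refine Finset.sum_congr rfl fun t _ => ?_
    rw [← Finset.prod_mul_distrib, ← Finset.prod_mul_distrib]
  have step : ∀ p q : X, h p * h q * (∑ j, c j * (G j p * G j q)) ^ N =
      ∑ t : Fin N → J, (∏ i, c (t i)) * ((h p * ∏ i, G (t i) p) * (h q * ∏ i, G (t i) q)) := by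
    intro p q
    rw [hexp, Finset.mul_sum]
    exact Finset.sum_congr rfl fun t _ => by ring
  simp_rw [step]
  have hswap : ∑ p : X, ∑ q : X, ∑ t : Fin N → J, (∏ i, c (t i)) * ((h p * ∏ i, G (t i) p) * (h q * ∏ i, G (t i) q)) =
      ∑ t : Fin N → J, (∏ i, c (t i)) * ((∑ p, h p * ∏ i, G (t i) p) * (∑ q, h q * ∏ i, G (t i) q)) := by
    rw [Finset.sum_congr rfl fun p _ => Finset.sum_comm, Finset.sum_comm]
    refine Finset.sum_congr rfl fun t _ => ?_
    rw [Finset.sum_mul_sum, Finset.mul_sum]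
    refine Finset.sum_congr rfl fun p _ => ?_
    rw [Finset.mul_sum]
  rw [hswap]
  exact Finset.sum_nonneg fun t _ => mul_nonneg (Finset.prod_nonneg fun i _ => hc _) (mul_self_nonneg _)

/-- **Entrywise exponentials of non-negative combinations of rank-one kernels are positive semidefinite** (Schur): for `c ≥ 0`,
`0 ≤ ∑_{p,q} h(p) h(q) exp(∑_j c_j G_j(p) G_j(q))` (power series of `exp`, `sum_mul_mul_pow_sum_nonneg` termwise).
[cite: MessagerMiracleSolePfister1978, Prop. 1] -/
theorem sum_mul_mul_exp_sum_nonneg {X J : Type*} [Fintype X] [Fintype J] (h : X → ℝ) (c : J → ℝ) (hc : ∀ j, 0 ≤ c j)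
    (G : J → X → ℝ) :
    0 ≤ ∑ p, ∑ q, h p * h q * Real.exp (∑ j, c j * (G j p * G j q)) := by
  set M : X → X → ℝ := fun p q => ∑ j, c j * (G j p * G j q) with hM
  have hK : ∀ p q : X, HasSum (fun N : ℕ => M p q ^ N / (N.factorial : ℝ)) (Real.exp (M p q)) := by
    intro p q
    rw [Real.exp_eq_exp_ℝ]
    exact NormedSpace.expSeries_div_hasSum_exp (M p q)
  have hsum : HasSum (fun N : ℕ => ∑ p, ∑ q, h p * h q * (M p q ^ N / (N.factorial : ℝ)))
      (∑ p, ∑ q, h p * h q * Real.exp (M p q)) :=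
    hasSum_sum fun p _ => hasSum_sum fun q _ => (hK p q).mul_left (h p * h q)
  refine hsum.nonneg fun N => ?_
  have : ∑ p, ∑ q, h p * h q * (M p q ^ N / (N.factorial : ℝ)) = (∑ p, ∑ q, h p * h q * M p q ^ N) / (N.factorial : ℝ) := by
    rw [div_eq_mul_inv, Finset.sum_mul]
    refine Finset.sum_congr rfl fun p _ => ?_
    rw [Finset.sum_mul]
    refine Finset.sum_congr rfl fun q _ => by ring
  rw [this]
  exact div_nonneg (sum_mul_mul_pow_sum_nonneg h c hc G N) (Nat.cast_nonneg _)

/-! ### `ℤ₃` bookkeeping: the angle `2π·val(m)/3` depends on `m` only modulo multiples of `2π` -/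

/-- If the integer `z` represents `m ∈ ℤ₃` then the angles `2π·val(m)/3` and `2πz/3` differ by an integer multiple of `2π`. [folklore] -/
theorem exists_angle_val_eq (m : ZMod 3) (z : ℤ) (h : (z : ZMod 3) = m) :
    ∃ j : ℤ, 2 * π * ((m.val : ℕ) : ℝ) / 3 = 2 * π * (z : ℝ) / 3 + (j : ℝ) * (2 * π) := by
  have h1 : ((m.val : ℤ) : ZMod 3) = (z : ZMod 3) := by
    rw [h, Int.cast_natCast, ZMod.natCast_zmod_val]
  have h2 : (3 : ℤ) ∣ z - (m.val : ℤ) := ((ZMod.intCast_eq_intCast_iff (m.val : ℤ) z 3).1 h1).dvd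
  obtain ⟨j, hj⟩ := h2
  refine ⟨-j, ?_⟩
  have hz : ((m.val : ℕ) : ℝ) = (z : ℝ) - 3 * (j : ℝ) := by
    have : ((m.val : ℤ) : ℝ) = (z : ℝ) - 3 * (j : ℝ) := by
      have e : (m.val : ℤ) = z - 3 * j := by linarith
      rw [e]; push_cast; ring
    exact_mod_cast this
  rw [hz]; push_cast; ring

/-- `cos(2π·val(m)/3 + c) = cos(2πz/3 + c)` whenever the integer `z` represents `m ∈ ℤ₃`. [folklore] -/
theorem cos_angle_val (m : ZMod 3) (z : ℤ) (h : (z : ZMod 3) = m) (c : ℝ) :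
    Real.cos (2 * π * ((m.val : ℕ) : ℝ) / 3 + c) = Real.cos (2 * π * (z : ℝ) / 3 + c) := by
  obtain ⟨j, hj⟩ := exists_angle_val_eq m z h
  rw [hj, show 2 * π * (z : ℝ) / 3 + (j : ℝ) * (2 * π) + c = (2 * π * (z : ℝ) / 3 + c) + (j : ℝ) * (2 * π) by ring,
    Real.cos_add_int_mul_two_pi]

/-- **The half-angle identities on `ℤ₃`.**  For `P, Q ∈ ℤ₃` and real `φ`, with `α = 2π·val(P)/3 + φ/2`, `β = 2π·val(Q)/3 + φ/2`:
`cos(2π·val(P−Q)/3) + cos(2π·val(P+Q)/3 + φ) = 2 cos α cos β` and `cos(2π·val(P−Q)/3) − cos(2π·val(P+Q)/3 + φ) = −2 sin α sin β`.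
[cite: MessagerMiracleSolePfister1978, Prop. 1] -/
theorem cos_val_sub_add_cos_val_add (P Q : ZMod 3) (φ : ℝ) :
    Real.cos (2 * π * (((P - Q).val : ℕ) : ℝ) / 3) + Real.cos (2 * π * (((P + Q).val : ℕ) : ℝ) / 3 + φ) =
        2 * (Real.cos (2 * π * ((P.val : ℕ) : ℝ) / 3 + φ / 2) * Real.cos (2 * π * ((Q.val : ℕ) : ℝ) / 3 + φ / 2)) ∧
      Real.cos (2 * π * (((P - Q).val : ℕ) : ℝ) / 3) - Real.cos (2 * π * (((P + Q).val : ℕ) : ℝ) / 3 + φ) =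
        2 * (Real.sin (2 * π * ((P.val : ℕ) : ℝ) / 3 + φ / 2) * Real.sin (2 * π * ((Q.val : ℕ) : ℝ) / 3 + φ / 2)) := by
  have hsub : (((P.val : ℤ) - (Q.val : ℤ) : ℤ) : ZMod 3) = P - Q := by
    push_cast; rw [ZMod.natCast_zmod_val, ZMod.natCast_zmod_val]
  have hadd : (((P.val : ℤ) + (Q.val : ℤ) : ℤ) : ZMod 3) = P + Q := by
    push_cast; rw [ZMod.natCast_zmod_val, ZMod.natCast_zmod_val]
  have e1 : Real.cos (2 * π * (((P - Q).val : ℕ) : ℝ) / 3) = Real.cos (2 * π * (((P.val : ℤ) - (Q.val : ℤ) : ℤ) : ℝ) / 3 + 0) := by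
    rw [← cos_angle_val (P - Q) _ hsub 0, add_zero]
  have e2 : Real.cos (2 * π * (((P + Q).val : ℕ) : ℝ) / 3 + φ) = Real.cos (2 * π * (((P.val : ℤ) + (Q.val : ℤ) : ℤ) : ℝ) / 3 + φ) :=
    cos_angle_val (P + Q) _ hadd φ
  have trig1 : ∀ α β : ℝ, Real.cos (α - β) + Real.cos (α + β) = 2 * (Real.cos α * Real.cos β) := by
    intro α β; rw [Real.cos_sub, Real.cos_add]; ring
  have trig2 : ∀ α β : ℝ, Real.cos (α - β) - Real.cos (α + β) = 2 * (Real.sin α * Real.sin β) := by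
    intro α β; rw [Real.cos_sub, Real.cos_add]; ring
  have f1 : 2 * π * (((P.val : ℤ) - (Q.val : ℤ) : ℤ) : ℝ) / 3 + 0 =
      (2 * π * ((P.val : ℕ) : ℝ) / 3 + φ / 2) - (2 * π * ((Q.val : ℕ) : ℝ) / 3 + φ / 2) := by push_cast; ring
  have f2 : 2 * π * (((P.val : ℤ) + (Q.val : ℤ) : ℤ) : ℝ) / 3 + φ =
      (2 * π * ((P.val : ℕ) : ℝ) / 3 + φ / 2) + (2 * π * ((Q.val : ℕ) : ℝ) / 3 + φ / 2) := by push_cast; ring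
  rw [e1, e2, f1, f2]
  exact ⟨trig1 _ _, trig2 _ _⟩

/-! ### The duplication identity -/

/-- Differences of edge spins: `(p − q)_u − (p − q)_v = (p_u − p_v) − (q_u − q_v)` and `(p + q)_u − (p + q)_v = (p_u − p_v) + (q_u − q_v)`.
[folklore] -/
theorem sub_apply_sub_sub_apply (p q : Fin n → ZMod 3) (u v : Fin n) :
    (p - q) u - (p - q) v = (p u - p v) - (q u - q v) ∧ (p + q) u - (p + q) v = (p u - p v) + (q u - q v) := by
  simp only [Pi.sub_apply, Pi.add_apply]
  constructor <;> ring

/-- **THE MMP DUPLICATION IDENTITY FOR `ℤ₃`.**  For couplings `a`, phases `φ`, vertices `b, t` and every real `ψ`: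
`∑_{k,k'} (cos(2πk_{bt}/3) − cos(2πk'_{bt}/3 − ψ)) w_{a,0}(k) w_{a,φ}(k') = 2 ∑_{p,q} h(p) h(q) exp(∑_{(u,v)} 2a_{uv} G_{uv}(p) G_{uv}(q))`,
`h(p) = sin(2π(p_b−p_t)/3 − ψ/2)`, `G_{uv}(p) = cos(2π(p_u−p_v)/3 + φ_{uv}/2)` — substitution `k = p − q`, `k' = p + q` (a bijection of
`(ℤ₃^n)²` since `2` is a unit of `ℤ₃`) and the half-angle identities. [cite: MessagerMiracleSolePfister1978, Prop. 1] -/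
theorem chiralClock_duplication (a φ : Fin n → Fin n → ℝ) (b t : Fin n) (ψ : ℝ) :
    ∑ k : Fin n → ZMod 3, ∑ k' : Fin n → ZMod 3,
      (Real.cos (2 * π * (((k b - k t).val : ℕ) : ℝ) / 3) - Real.cos (2 * π * (((k' b - k' t).val : ℕ) : ℝ) / 3 + -ψ)) *
        (chiralClockWeight a (fun _ _ => 0) k * chiralClockWeight a φ k') =
    2 * ∑ p : Fin n → ZMod 3, ∑ q : Fin n → ZMod 3,
      -Real.sin (2 * π * (((p b - p t).val : ℕ) : ℝ) / 3 + -ψ / 2) * -Real.sin (2 * π * (((q b - q t).val : ℕ) : ℝ) / 3 + -ψ / 2) *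
        Real.exp (∑ j : Fin n × Fin n, 2 * a j.1 j.2 *
          (Real.cos (2 * π * (((p j.1 - p j.2).val : ℕ) : ℝ) / 3 + φ j.1 j.2 / 2) *
            Real.cos (2 * π * (((q j.1 - q j.2).val : ℕ) : ℝ) / 3 + φ j.1 j.2 / 2))) := by
  classical
  -- the substitution
  have key1 : ∀ u v : ZMod 3, 2 * (u - v + (u + v)) = u := by decide
  have key2 : ∀ u v : ZMod 3, 2 * (u + v - (u - v)) = v := by decide
  have key3 : ∀ u v : ZMod 3, 2 * (u + v) - 2 * (v - u) = u := by decide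
  have key4 : ∀ u v : ZMod 3, 2 * (u + v) + 2 * (v - u) = v := by decide
  let e : (Fin n → ZMod 3) × (Fin n → ZMod 3) ≃ (Fin n → ZMod 3) × (Fin n → ZMod 3) :=
    { toFun := fun pq => (pq.1 - pq.2, pq.1 + pq.2)
      invFun := fun kk => (fun x => 2 * (kk.1 x + kk.2 x), fun x => 2 * (kk.2 x - kk.1 x))
      left_inv := fun pq => by
        refine Prod.ext (funext fun x => ?_) (funext fun x => ?_)
        · simp only [Pi.sub_apply, Pi.add_apply, key1]
        · simp only [Pi.sub_apply, Pi.add_apply, key2]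
      right_inv := fun kk => by
        refine Prod.ext (funext fun x => ?_) (funext fun x => ?_)
        · simp only [Pi.sub_apply, key3]
        · simp only [Pi.add_apply, key4] }
  -- termwise identity after the substitution
  have hterm : ∀ p q : Fin n → ZMod 3,
      (Real.cos (2 * π * ((((p - q) b - (p - q) t).val : ℕ) : ℝ) / 3) -
          Real.cos (2 * π * ((((p + q) b - (p + q) t).val : ℕ) : ℝ) / 3 + -ψ)) *
        (chiralClockWeight a (fun _ _ => 0) (p - q) * chiralClockWeight a φ (p + q)) =
      2 * (-Real.sin (2 * π * (((p b - p t).val : ℕ) : ℝ) / 3 + -ψ / 2) * -Real.sin (2 * π * (((q b - q t).val : ℕ) : ℝ) / 3 + -ψ / 2) *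
        Real.exp (∑ j : Fin n × Fin n, 2 * a j.1 j.2 *
          (Real.cos (2 * π * (((p j.1 - p j.2).val : ℕ) : ℝ) / 3 + φ j.1 j.2 / 2) *
            Real.cos (2 * π * (((q j.1 - q j.2).val : ℕ) : ℝ) / 3 + φ j.1 j.2 / 2)))) := by
    intro p q
    -- observable
    have hobs : Real.cos (2 * π * ((((p - q) b - (p - q) t).val : ℕ) : ℝ) / 3) -
        Real.cos (2 * π * ((((p + q) b - (p + q) t).val : ℕ) : ℝ) / 3 + -ψ) =
        2 * (Real.sin (2 * π * (((p b - p t).val : ℕ) : ℝ) / 3 + -ψ / 2) *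
          Real.sin (2 * π * (((q b - q t).val : ℕ) : ℝ) / 3 + -ψ / 2)) := by
      rw [(sub_apply_sub_sub_apply p q b t).1, (sub_apply_sub_sub_apply p q b t).2]
      exact (cos_val_sub_add_cos_val_add (p b - p t) (q b - q t) (-ψ)).2
    -- weights
    have hw : chiralClockWeight a (fun _ _ => 0) (p - q) * chiralClockWeight a φ (p + q) =
        Real.exp (∑ j : Fin n × Fin n, 2 * a j.1 j.2 *
          (Real.cos (2 * π * (((p j.1 - p j.2).val : ℕ) : ℝ) / 3 + φ j.1 j.2 / 2) *
            Real.cos (2 * π * (((q j.1 - q j.2).val : ℕ) : ℝ) / 3 + φ j.1 j.2 / 2))) := by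
      unfold chiralClockWeight
      rw [← Real.exp_add]
      congr 1
      rw [Fintype.sum_prod_type' (f := fun x y => 2 * a x y *
          (Real.cos (2 * π * (((p x - p y).val : ℕ) : ℝ) / 3 + φ x y / 2) *
            Real.cos (2 * π * (((q x - q y).val : ℕ) : ℝ) / 3 + φ x y / 2))), ← Finset.sum_add_distrib]
      refine Finset.sum_congr rfl fun x _ => ?_
      rw [← Finset.sum_add_distrib]
      refine Finset.sum_congr rfl fun y _ => ?_
      have hxy := (cos_val_sub_add_cos_val_add (p x - p y) (q x - q y) (φ x y)).1
      rw [(sub_apply_sub_sub_apply p q x y).1, (sub_apply_sub_sub_apply p q x y).2]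
      simp only [add_zero]
      linear_combination (a x y) * hxy
    rw [hobs, hw]
    ring
  -- reindex the double sum through `e`
  let F : (Fin n → ZMod 3) → (Fin n → ZMod 3) → ℝ := fun k k' =>
    (Real.cos (2 * π * (((k b - k t).val : ℕ) : ℝ) / 3) - Real.cos (2 * π * (((k' b - k' t).val : ℕ) : ℝ) / 3 + -ψ)) *
      (chiralClockWeight a (fun _ _ => 0) k * chiralClockWeight a φ k')
  let R : (Fin n → ZMod 3) → (Fin n → ZMod 3) → ℝ := fun p q =>
    -Real.sin (2 * π * (((p b - p t).val : ℕ) : ℝ) / 3 + -ψ / 2) * -Real.sin (2 * π * (((q b - q t).val : ℕ) : ℝ) / 3 + -ψ / 2) *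
      Real.exp (∑ j : Fin n × Fin n, 2 * a j.1 j.2 *
        (Real.cos (2 * π * (((p j.1 - p j.2).val : ℕ) : ℝ) / 3 + φ j.1 j.2 / 2) *
          Real.cos (2 * π * (((q j.1 - q j.2).val : ℕ) : ℝ) / 3 + φ j.1 j.2 / 2)))
  show ∑ k, ∑ k', F k k' = 2 * ∑ p, ∑ q, R p q
  have L : ∑ kk : (Fin n → ZMod 3) × (Fin n → ZMod 3), F kk.1 kk.2 =
      ∑ pq : (Fin n → ZMod 3) × (Fin n → ZMod 3), F (e pq).1 (e pq).2 := (e.sum_comp (fun kk => F kk.1 kk.2)).symm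
  rw [← Fintype.sum_prod_type', ← Fintype.sum_prod_type', Finset.mul_sum, L]
  exact Finset.sum_congr rfl fun pq _ => hterm pq.1 pq.2

/-! ### The comparison theorem -/

/-- The partition function of the chiral clock model is positive. [folklore] -/
theorem sum_chiralClockWeight_pos (a φ : Fin n → Fin n → ℝ) : 0 < ∑ k : Fin n → ZMod 3, chiralClockWeight a φ k :=
  Finset.sum_pos (fun k _ => by unfold chiralClockWeight; exact Real.exp_pos _) Finset.univ_nonempty

/-- The real part of the rotated two-point function: `Re(e^{−iψ} ⟨ω^{k_b−k_t}⟩_{a,φ}) = (∑_k w_{a,φ}(k) cos(2πk_{bt}/3 − ψ)) / Z_{a,φ}`.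
[folklore] -/
theorem re_exp_mul_chiralClockCorr (a φ : Fin n → Fin n → ℝ) (b t : Fin n) (ψ : ℝ) :
    (Complex.exp (-(ψ : ℂ) * Complex.I) * chiralClockCorr a φ b t).re =
      (∑ k : Fin n → ZMod 3, chiralClockWeight a φ k * Real.cos (2 * π * (((k b - k t).val : ℕ) : ℝ) / 3 + -ψ)) /
        ∑ k : Fin n → ZMod 3, chiralClockWeight a φ k := by
  unfold chiralClockCorr
  rw [← Complex.ofReal_sum, ← mul_div_assoc, Complex.div_ofReal_re, Finset.mul_sum, Complex.re_sum]
  congr 1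
  refine Finset.sum_congr rfl fun k _ => ?_
  unfold omegaPow
  have : Complex.exp (-(ψ : ℂ) * Complex.I) * ((chiralClockWeight a φ k : ℂ) *
      Complex.exp (2 * (Real.pi : ℂ) * Complex.I * (((k b - k t).val : ℕ) : ℂ) / 3)) =
      (chiralClockWeight a φ k : ℂ) * Complex.exp (((2 * π * (((k b - k t).val : ℕ) : ℝ) / 3 + -ψ : ℝ) : ℂ) * Complex.I) := by
    rw [mul_left_comm, ← Complex.exp_add]
    congr 2
    push_cast
    ring
  rw [this, Complex.re_ofReal_mul, Complex.exp_ofReal_mul_I_re]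

/-- **ROTATED COMPARISON.**  For `a ≥ 0`, all `φ`, `b, t` and every real `ψ`: `Re(e^{−iψ} ⟨ω^{k_b−k_t}⟩_{a,φ}) ≤ Re ⟨ω^{k_b−k_t}⟩_{a,0}`
(cross-multiply by the two positive partition functions; the difference is the duplication sum `chiralClock_duplication`, non-negative by
`sum_mul_mul_exp_sum_nonneg`). [cite: MessagerMiracleSolePfister1978, Prop. 1] -/
theorem re_exp_mul_chiralClockCorr_le (a φ : Fin n → Fin n → ℝ) (ha : ∀ x y, 0 ≤ a x y) (b t : Fin n) (ψ : ℝ) :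
    (Complex.exp (-(ψ : ℂ) * Complex.I) * chiralClockCorr a φ b t).re ≤ (chiralClockCorr a (fun _ _ => 0) b t).re := by
  have h0 : (chiralClockCorr a (fun _ _ => 0) b t).re = (Complex.exp (-((0 : ℝ) : ℂ) * Complex.I) * chiralClockCorr a (fun _ _ => 0) b t).re := by
    simp
  rw [h0, re_exp_mul_chiralClockCorr, re_exp_mul_chiralClockCorr]
  have hZ0 := sum_chiralClockWeight_pos a (fun _ _ => 0)
  have hZ1 := sum_chiralClockWeight_pos a φ
  rw [div_le_div_iff₀ hZ1 hZ0]
  -- the difference is the duplication sum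
  have hD := chiralClock_duplication a φ b t ψ
  have hnonneg : 0 ≤ ∑ k : Fin n → ZMod 3, ∑ k' : Fin n → ZMod 3,
      (Real.cos (2 * π * (((k b - k t).val : ℕ) : ℝ) / 3) - Real.cos (2 * π * (((k' b - k' t).val : ℕ) : ℝ) / 3 + -ψ)) *
        (chiralClockWeight a (fun _ _ => 0) k * chiralClockWeight a φ k') := by
    rw [hD]
    refine mul_nonneg (by norm_num) ?_
    have := sum_mul_mul_exp_sum_nonneg (X := Fin n → ZMod 3) (J := Fin n × Fin n)
      (fun p => -Real.sin (2 * π * (((p b - p t).val : ℕ) : ℝ) / 3 + -ψ / 2)) (fun j => 2 * a j.1 j.2)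
      (fun j => by have := ha j.1 j.2; positivity)
      (fun j p => Real.cos (2 * π * (((p j.1 - p j.2).val : ℕ) : ℝ) / 3 + φ j.1 j.2 / 2))
    simpa using this
  -- expand the difference: A₀ Z₁ − A₁ Z₀
  have hsplit : ∑ k : Fin n → ZMod 3, ∑ k' : Fin n → ZMod 3,
      (Real.cos (2 * π * (((k b - k t).val : ℕ) : ℝ) / 3) - Real.cos (2 * π * (((k' b - k' t).val : ℕ) : ℝ) / 3 + -ψ)) *
        (chiralClockWeight a (fun _ _ => 0) k * chiralClockWeight a φ k') =
      (∑ k : Fin n → ZMod 3, chiralClockWeight a (fun _ _ => 0) k * Real.cos (2 * π * (((k b - k t).val : ℕ) : ℝ) / 3 + -(0 : ℝ))) *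
          (∑ k : Fin n → ZMod 3, chiralClockWeight a φ k) -
        (∑ k : Fin n → ZMod 3, chiralClockWeight a φ k * Real.cos (2 * π * (((k b - k t).val : ℕ) : ℝ) / 3 + -ψ)) *
          (∑ k : Fin n → ZMod 3, chiralClockWeight a (fun _ _ => 0) k) := by
    have e1 : ∀ k k' : Fin n → ZMod 3,
        (Real.cos (2 * π * (((k b - k t).val : ℕ) : ℝ) / 3) - Real.cos (2 * π * (((k' b - k' t).val : ℕ) : ℝ) / 3 + -ψ)) *
          (chiralClockWeight a (fun _ _ => 0) k * chiralClockWeight a φ k') =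
        chiralClockWeight a (fun _ _ => 0) k * Real.cos (2 * π * (((k b - k t).val : ℕ) : ℝ) / 3 + -(0 : ℝ)) *
            chiralClockWeight a φ k' -
          chiralClockWeight a φ k' * Real.cos (2 * π * (((k' b - k' t).val : ℕ) : ℝ) / 3 + -ψ) *
            chiralClockWeight a (fun _ _ => 0) k := by
      intro k k'; rw [neg_zero, add_zero]; ring
    simp_rw [e1, Finset.sum_sub_distrib]
    rw [← Finset.sum_mul_sum, Finset.sum_comm, ← Finset.sum_mul_sum]
  rw [hsplit] at hnonneg
  linarith

/-- **GRIFFITHS' FIRST INEQUALITY for the `ℤ₃` clock ferromagnet**: `0 ≤ Re ⟨ω^{k_b−k_t}⟩_{a,0}` for `a ≥ 0`. [folklore] -/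
theorem chiralClockCorr_zero_re_nonneg (a : Fin n → Fin n → ℝ) (ha : ∀ x y, 0 ≤ a x y) (b t : Fin n) :
    0 ≤ (chiralClockCorr a (fun _ _ => 0) b t).re := by
  have h1 := re_exp_mul_chiralClockCorr_le a (fun _ _ => 0) ha b t 0
  have h2 := re_exp_mul_chiralClockCorr_le a (fun _ _ => 0) ha b t π
  have e : Complex.exp (-(π : ℂ) * Complex.I) = -1 := by
    rw [show -(π : ℂ) * Complex.I = -(π * Complex.I) by ring, Complex.exp_neg, Complex.exp_pi_mul_I]; norm_num
  rw [e] at h2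
  simp only [neg_mul, one_mul, Complex.neg_re] at h2
  linarith

/-- **THEOREM (C): the chiral `ℤ₃` clock comparison `ChiralClockComparison` holds.**  For every `n`, all `a ≥ 0`, all `φ`, all `b, t`:
`‖⟨ω^{k_b−k_t}⟩_{a,φ}‖ ≤ Re ⟨ω^{k_b−k_t}⟩_{a,0}` — rotate by `ψ = arg ⟨ω^{k_b−k_t}⟩_{a,φ}` and apply `re_exp_mul_chiralClockCorr_le`.
[cite: MessagerMiracleSolePfister1978, Prop. 1] -/
theorem chiralClockComparison_holds : ChiralClockComparison := by
  intro n a φ ha b t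
  set c := chiralClockCorr a φ b t with hc
  have hrot : (Complex.exp (-(Complex.arg c : ℂ) * Complex.I) * c).re = ‖c‖ := by
    have h := Complex.norm_mul_exp_arg_mul_I c
    have : Complex.exp (-(Complex.arg c : ℂ) * Complex.I) * c = (‖c‖ : ℂ) := by
      calc Complex.exp (-(Complex.arg c : ℂ) * Complex.I) * c
          = Complex.exp (-(Complex.arg c : ℂ) * Complex.I) * ((‖c‖ : ℂ) * Complex.exp ((Complex.arg c : ℂ) * Complex.I)) := by
            rw [h]
        _ = (‖c‖ : ℂ) * Complex.exp (-(Complex.arg c : ℂ) * Complex.I + (Complex.arg c : ℂ) * Complex.I) := by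
            rw [Complex.exp_add]; ring
        _ = (‖c‖ : ℂ) := by rw [show -(Complex.arg c : ℂ) * Complex.I + (Complex.arg c : ℂ) * Complex.I = 0 by ring,
            Complex.exp_zero, mul_one]
    rw [this, Complex.ofReal_re]
  rw [← hrot]
  exact re_exp_mul_chiralClockCorr_le a φ ha b t (Complex.arg c)

end Summit.Ventures.YMGap.Conjectures

end
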